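import Mathlib

/-!
# LEMMA MH `MultiHubRigid q p` for EVERY admissible pair, hence an's `MultiHubRigidLaw` (cell bsd-f2-manin, analytic lens g30, MEMO-an §72.10 /
# Sketch-an-g30 §7 / PROOFS-an-72 §5 (5.4c); the finite-group rigidity behind E-an-142 `TVPatternRigidity`, inputs of C3 AND C2)

Summit `BirchSwinnertonDyer`, route `ManinLocalTwoThree`, cruxes C3 `ManinPrimeToThreeAtNine` (stmt-BirchSwinnertonDyer-22968, `p = 3`) / C2
`ManinOddAtFour` (stmt-…-22967, `p = 2`).  LEMMA MH: for primes `q ≥ 3`, `p` with `p ∤ (q−1)/2`, an even `G : ℤ/q → ℤ/p` with the multi-hub relation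
`G(h) − G(hD) − G(h(1−D)/D) + G(h(1−D)) = 0` (`h ≠ 0`, `D ∉ {0,1}`) is constant on `(ℤ/q)ˣ`.

PROOF (shorter than PROOFS-an-72 (5.4c): no Jacobsthal count, no case `ord ψ ≥ 3` / `= 2`).  Put `m = (q−1)/2`, `g` a generator of `(ℤ/q)ˣ`
(`g^m = −1`), `ζ` a primitive `m`-th root of unity in `K = CyclotomicField m (ℤ/p)` (`p ∤ m`), `F = G` viewed in `K`, and for `0 ≤ k < m` the
EVEN character sums `Λ_k(u) = Σ_{i<m} F(gⁱu) ζ^{ki}` (well adapted because `F` is even and `ζ^{km} = 1`: SHIFT `ζ^{ka} Λ_k(gᵃu) = Λ_k(u)`).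
The relation at `h = λw`, `D = (w−1)/w` reads `F(λw) − F(λ(w−1)) − F(λw/(w−1)) + F(λ) = 0`; summing against `ζ^{ki}` over `λ = gⁱ` and
shifting (`w − 1 = g^{a₁}`, `w/(w−1) = g^{a₂}`, `w = g^{a₁+a₂}`) gives `(1 − ζ^{ka₁})(1 − ζ^{ka₂}) Λ_k(1) = 0` — i.e. for the even character
`ψ = ψ_k`, `ψ(w−1) = 1` or `ψ(w) = ψ(w−1)`.  WALK: if `Λ_k(1) ≠ 0` and `0 < k < m` then `ψ(g) = ζᵏ ≠ 1`, and stepping `w = n+1` for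
`n = g, g+1, …, q−2` (as residues) keeps `ψ(n) = ζᵏ ≠ 1`, up to `ψ(q−1) = ψ(−1) = ζ^{km} = 1`: contradiction.  So `Λ_k(1) = 0` for `0 < k < m`,
and the orthogonality `Σ_{k<m} ζ^{kt} = m·[m ∣ t]` gives `m·F(gʲ) = Λ_0(1) = m·F(1)`: `F` is constant on the units (`m ≠ 0` in `K`).  ∎
(The hypothesis `p ∤ m` enters twice: `ζ` exists / `m` is invertible in characteristic `p`.  For `p ∣ m` the even homomorphisms `(ℤ/q)ˣ → ℤ/p`
are non-constant solutions — an's excluded pairs.)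

* `multiHubRigid` — `MultiHubRigid q p` (Sketch-an-g30 §7 VERBATIM, by value) for `q, p` prime, `3 ≤ q`, `p ∤ (q−1)/2`;
* `multiHubRigidLaw` — an's `MultiHubRigidLaw` (§7 VERBATIM, by value; the binder `q ≠ p` is not needed).

HONEST FRAMING: a finite-group lemma; E-an-142 needs in addition the `SL(2,ℤ)` bookkeeping `MultiHubImpliesRigidity` (PROOFS-an-72 §5.0–5.5,
not here).  Nothing about Manin's conjecture or BSD is proved by this.
-/

set_option linter.dupNamespace false
set_option autoImplicit false

namespace Summit.BirchSwinnertonDyer.BirchSwinnertonDyer.Theorems.ManinLocalTwoThree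

open Finset

section MultiHub

variable {q : ℕ} [Fact q.Prime] {K : Type*} [Field K]

/-- The multi-hub relation at `h = λ w`, `D = (w−1)/w`: `G(λw) − G(λ(w−1)) − G(λ·w/(w−1)) + G(λ) = 0`. -/
theorem multiHub_rel {A : Type*} [AddCommGroup A] (G : ZMod q → A)
    (hMH : ∀ h D : ZMod q, h ≠ 0 → D ≠ 0 → D ≠ 1 → G h - G (h * D) - G (h * (1 - D) * D⁻¹) + G (h * (1 - D)) = 0)
    {lam w : ZMod q} (hlam : lam ≠ 0) (hw0 : w ≠ 0) (hw1 : w ≠ 1) :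
    G (lam * w) - G (lam * (w - 1)) - G (lam * (w * (w - 1)⁻¹)) + G lam = 0 := by
  have hw1' : w - 1 ≠ 0 := sub_ne_zero.mpr hw1
  have h := hMH (lam * w) ((w - 1) * w⁻¹) (mul_ne_zero hlam hw0)
    (mul_ne_zero hw1' (inv_ne_zero hw0)) (by
      intro h1
      have : (w - 1) * w⁻¹ * w = w := by rw [h1, one_mul]
      rw [inv_mul_cancel_right₀ hw0] at this
      exact absurd (sub_eq_self.mp this) one_ne_zero)
  have e1 : lam * w * ((w - 1) * w⁻¹) = lam * (w - 1) := by field_simp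
  have e2 : lam * w * (1 - (w - 1) * w⁻¹) * ((w - 1) * w⁻¹)⁻¹ = lam * (w * (w - 1)⁻¹) := by field_simp; ring
  have e3 : lam * w * (1 - (w - 1) * w⁻¹) = lam := by field_simp; ring
  rw [e1, e2, e3] at h
  exact h

/-- Sums of an `m`-periodic sequence over a window of length `m` do not depend on the window. -/
theorem sum_range_add_of_periodic {A : Type*} [AddCommGroup A] {m : ℕ} (f : ℕ → A) (hf : ∀ i, f (i + m) = f i)
    (a : ℕ) : ∑ i ∈ range m, f (i + a) = ∑ i ∈ range m, f i := by
  induction a with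
  | zero => simp
  | succ a ih =>
    have h1 : ∑ i ∈ range m, f (i + (a + 1)) = ∑ i ∈ range m, f ((i + 1) + a) := by
      refine sum_congr rfl fun i _ ↦ ?_; congr 1; ring
    have h2 : ∑ i ∈ range (m + 1), f (i + a) = (∑ i ∈ range m, f ((i + 1) + a)) + f (0 + a) := sum_range_succ' _ _
    have h3 : ∑ i ∈ range (m + 1), f (i + a) = (∑ i ∈ range m, f (i + a)) + f (m + a) := sum_range_succ _ _
    rw [h1]
    have h4 : f (m + a) = f (0 + a) := by rw [zero_add, add_comm, hf]
    have : ∑ i ∈ range m, f ((i + 1) + a) = ∑ i ∈ range m, f (i + a) := by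
      have := h2.symm.trans h3
      rw [h4] at this
      exact add_right_cancel this
    rw [this, ih]

/-- Orthogonality: `Σ_{k<m} ζ^{tk} = m` if `m ∣ t`, else `0`, for a primitive `m`-th root `ζ`. -/
theorem sum_pow_mul_eq {m : ℕ} {ζ : K} (hζ : IsPrimitiveRoot ζ m) (t : ℕ) :
    ∑ k ∈ range m, ζ ^ (t * k) = if m ∣ t then (m : K) else 0 := by
  have hpow : ∀ k, ζ ^ (t * k) = (ζ ^ t) ^ k := fun k ↦ pow_mul ζ t k
  simp_rw [hpow]
  split_ifs with h
  · rw [(hζ.pow_eq_one_iff_dvd t).mpr h]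
    simp
  · have hne : ζ ^ t ≠ 1 := fun h1 ↦ h ((hζ.pow_eq_one_iff_dvd t).mp h1)
    have hgeom := geom_sum_mul (ζ ^ t) m
    rw [← pow_mul, mul_comm t m, pow_mul ζ m t, hζ.pow_eq_one, one_pow, sub_self] at hgeom
    rcases mul_eq_zero.mp hgeom with h0 | h0 <;> first | exact h0 | exact absurd (sub_eq_zero.mp h0) hne

variable {m : ℕ} {g : ZMod q} {ζ : K} (F : ZMod q → K)

/-- SHIFT: `ζ^{ka} · Σ_{i<m} F(gⁱ·gᵃu) ζ^{ki} = Σ_{i<m} F(gⁱ u) ζ^{ki}` for even `F`, `g^m = −1`, `ζ^m = 1`. -/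
theorem charSum_shift (heven : ∀ x, F (-x) = F x) (hgm : g ^ m = -1) (hζm : ζ ^ m = 1) (k a : ℕ) (u : ZMod q) :
    ζ ^ (k * a) * ∑ i ∈ range m, F (g ^ i * (g ^ a * u)) * ζ ^ (k * i) = ∑ i ∈ range m, F (g ^ i * u) * ζ ^ (k * i) := by
  have hper : ∀ i, (fun i ↦ F (g ^ i * u) * ζ ^ (k * i)) (i + m) = (fun i ↦ F (g ^ i * u) * ζ ^ (k * i)) i := by
    intro i
    have h1 : g ^ (i + m) * u = -(g ^ i * u) := by rw [pow_add, hgm]; ring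
    have h2 : ζ ^ (k * (i + m)) = ζ ^ (k * i) := by
      rw [mul_add, pow_add, mul_comm k m, pow_mul ζ m k, hζm, one_pow, mul_one]
    show F (g ^ (i + m) * u) * ζ ^ (k * (i + m)) = F (g ^ i * u) * ζ ^ (k * i)
    rw [h1, heven, h2]
  rw [← sum_range_add_of_periodic (fun i ↦ F (g ^ i * u) * ζ ^ (k * i)) hper a, mul_sum]
  refine sum_congr rfl fun i _ ↦ ?_
  have h3 : g ^ i * (g ^ a * u) = g ^ (i + a) * u := by rw [pow_add]; ring
  show ζ ^ (k * a) * (F (g ^ i * (g ^ a * u)) * ζ ^ (k * i)) = F (g ^ (i + a) * u) * ζ ^ (k * (i + a))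
  rw [h3, mul_add, pow_add]
  ring

/-- The character-sum form of the multi-hub relation: with `w − 1 = g^{a₁}`, `w/(w−1) = g^{a₂}`,
`(1 − ζ^{ka₁})(1 − ζ^{ka₂}) · Λ_k = 0` where `Λ_k = Σ_{i<m} F(gⁱ) ζ^{ki}` (for the even character `ψ_k`: `ψ(w−1) = 1` or `ψ(w) = ψ(w−1)`). -/
theorem charSum_rel (heven : ∀ x, F (-x) = F x) (hgm : g ^ m = -1) (hζm : ζ ^ m = 1) (hg0 : g ≠ 0)
    (hrel : ∀ lam w : ZMod q, lam ≠ 0 → w ≠ 0 → w ≠ 1 →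
      F (lam * w) - F (lam * (w - 1)) - F (lam * (w * (w - 1)⁻¹)) + F lam = 0)
    {w : ZMod q} (hw0 : w ≠ 0) (hw1 : w ≠ 1) {a₁ a₂ : ℕ} (ha₁ : g ^ a₁ = w - 1) (ha₂ : g ^ a₂ = w * (w - 1)⁻¹) (k : ℕ) :
    (1 - ζ ^ (k * a₁)) * (1 - ζ ^ (k * a₂)) * ∑ i ∈ range m, F (g ^ i * 1) * ζ ^ (k * i) = 0 := by
  have hw1' : w - 1 ≠ 0 := sub_ne_zero.mpr hw1
  have e12 : g ^ (a₁ + a₂) * 1 = w := by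
    rw [pow_add, ha₁, ha₂, mul_one, mul_comm w, ← mul_assoc, mul_inv_cancel₀ hw1', one_mul]
  have e1 : g ^ a₁ * 1 = w - 1 := by rw [mul_one, ha₁]
  have e2 : g ^ a₂ * 1 = w * (w - 1)⁻¹ := by rw [mul_one, ha₂]
  have hsum : ∑ i ∈ range m, (F (g ^ i * (g ^ (a₁ + a₂) * 1)) * ζ ^ (k * i) - F (g ^ i * (g ^ a₁ * 1)) * ζ ^ (k * i)
      - F (g ^ i * (g ^ a₂ * 1)) * ζ ^ (k * i) + F (g ^ i * 1) * ζ ^ (k * i)) = 0 := by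
    refine sum_eq_zero fun i _ ↦ ?_
    have h := hrel (g ^ i) w (pow_ne_zero _ hg0) hw0 hw1
    rw [e12, e1, e2, mul_one]
    linear_combination (ζ ^ (k * i)) * h
  rw [sum_add_distrib, sum_sub_distrib, sum_sub_distrib] at hsum
  have hS1 := charSum_shift F heven hgm hζm k a₁ 1
  have hS2 := charSum_shift F heven hgm hζm k a₂ 1
  have hS12 := charSum_shift F heven hgm hζm k (a₁ + a₂) 1
  rw [mul_add, pow_add] at hS12
  linear_combination (ζ ^ (k * a₁) * ζ ^ (k * a₂)) * hsum - hS12 + ζ ^ (k * a₂) * hS1 + ζ ^ (k * a₁) * hS2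

/-- WALK: for `0 < k < m` the character sum `Λ_k = Σ_{i<m} F(gⁱ) ζ^{ki}` vanishes.  (If not, `ψ_k(n) = ζᵏ ≠ 1` propagates from
`n = g` to `n = q − 1 = −1` through `charSum_rel`, contradicting `ψ_k(−1) = ζ^{km} = 1`.) -/
theorem charSum_eq_zero (hm0 : 0 < m) (hinj : ∀ a b : ℕ, g ^ a = g ^ b → a ≡ b [MOD 2 * m]) (hg0 : g ≠ 0)
    (hgen : ∀ x : ZMod q, x ≠ 0 → ∃ a : ℕ, g ^ a = x) (hζ : IsPrimitiveRoot ζ m)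
    (heven : ∀ x, F (-x) = F x) (hgm : g ^ m = -1)
    (hrel : ∀ lam w : ZMod q, lam ≠ 0 → w ≠ 0 → w ≠ 1 →
      F (lam * w) - F (lam * (w - 1)) - F (lam * (w * (w - 1)⁻¹)) + F lam = 0)
    {k : ℕ} (hk0 : 0 < k) (hkm : k < m) :
    ∑ i ∈ range m, F (g ^ i * 1) * ζ ^ (k * i) = 0 := by
  by_contra hΛ
  have hζm : ζ ^ m = 1 := hζ.pow_eq_one
  have hζk : ζ ^ k ≠ 1 := hζ.pow_ne_one_of_pos_of_lt hk0.ne' hkm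
  have hq1 : 1 < q := (Fact.out : q.Prime).one_lt
  -- the residue `n₀ ∈ [1, q−1]` of `g`
  set n₀ : ℕ := g.val with hn₀
  have hn₀g : ((n₀ : ℕ) : ZMod q) = g := by rw [hn₀]; exact ZMod.natCast_zmod_val g
  have hn₀pos : 1 ≤ n₀ := by
    rw [Nat.one_le_iff_ne_zero, hn₀]
    exact (ZMod.val_ne_zero g).mpr hg0
  have hn₀lt : n₀ < q := by rw [hn₀]; exact ZMod.val_lt g
  -- the walk
  have walk : ∀ n, n₀ ≤ n → n ≤ q - 1 → ∃ a : ℕ, g ^ a = (n : ZMod q) ∧ ζ ^ (k * a) = ζ ^ k := by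
    intro n hn
    induction n, hn using Nat.le_induction with
    | base => intro _; exact ⟨1, by rw [pow_one, hn₀g], by rw [mul_one]⟩
    | succ n hn₀n ih =>
      intro hn1
      obtain ⟨a, hga, hζa⟩ := ih (by omega)
      set w : ZMod q := ((n + 1 : ℕ) : ZMod q) with hw
      have hwn : w - 1 = (n : ZMod q) := by rw [hw]; push_cast; ring
      have hw0 : w ≠ 0 := by
        rw [hw, Ne, ZMod.natCast_eq_zero_iff]
        intro hdvd
        have := Nat.le_of_dvd (by omega) hdvd
        omega
      have hw1 : w ≠ 1 := by
        intro h1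
        have h0 : (n : ZMod q) = 0 := by rw [← hwn, h1, sub_self]
        rw [ZMod.natCast_eq_zero_iff] at h0
        have := Nat.le_of_dvd (by omega) h0
        omega
      have hw1' : w - 1 ≠ 0 := sub_ne_zero.mpr hw1
      obtain ⟨a₂, ha₂⟩ := hgen (w * (w - 1)⁻¹) (mul_ne_zero hw0 (inv_ne_zero hw1'))
      have hga' : g ^ a = w - 1 := by rw [hga, hwn]
      have hrel' := charSum_rel F heven hgm hζm hg0 hrel hw0 hw1 hga' ha₂ k
      rw [hζa] at hrel'
      rcases mul_eq_zero.mp hrel' with h | h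
      · rcases mul_eq_zero.mp h with h' | h'
        · exact absurd (sub_eq_zero.mp h').symm hζk
        · refine ⟨a + a₂, ?_, ?_⟩
          · rw [pow_add, hga', ha₂, mul_comm w, ← mul_assoc, mul_inv_cancel₀ hw1', one_mul]
          · rw [mul_add, pow_add, hζa, ← sub_eq_zero.mp h', mul_one]
      · exact absurd h hΛ
  obtain ⟨a, hga, hζa⟩ := walk (q - 1) (by omega) le_rfl
  -- `g^a = −1 = g^m`, so `a ≡ m (mod 2m)` and `ζ^{ka} = 1`
  have hneg : ((q - 1 : ℕ) : ZMod q) = -1 := by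
    rw [Nat.cast_sub hq1.le, Nat.cast_one, ZMod.natCast_self, zero_sub]
  rw [hneg, ← hgm] at hga
  have hmod : a % (2 * m) = m := by
    have := hinj a m hga
    unfold Nat.ModEq at this
    rw [this]
    exact Nat.mod_eq_of_lt (by omega)
  have ha : a = 2 * m * (a / (2 * m)) + m := by
    conv_lhs => rw [← Nat.div_add_mod a (2 * m), hmod]
  apply hζk
  rw [← hζa, ha, show k * (2 * m * (a / (2 * m)) + m) = m * (k * (2 * (a / (2 * m)) + 1)) by ring, pow_mul, hζm, one_pow]

/-- If all the character sums `Λ_k`, `0 < k < m`, vanish then `F` is constant on the powers of `g` (orthogonality of the `ζ^{k·}`, `m ≠ 0` in `K`,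
and `g^m = −1` with evenness for exponents `≥ m`). -/
theorem apply_pow_eq_of_charSum_eq_zero (hm0 : 0 < m) (hζ : IsPrimitiveRoot ζ m) (hmK : (m : K) ≠ 0)
    (heven : ∀ x, F (-x) = F x) (hgm : g ^ m = -1)
    (hvan : ∀ k, 0 < k → k < m → ∑ i ∈ range m, F (g ^ i * 1) * ζ ^ (k * i) = 0) (j : ℕ) :
    F (g ^ j) = F 1 := by
  -- first for `j < m`
  have hkey : ∀ j, j < m → (m : K) * F (g ^ j) = ∑ i ∈ range m, F (g ^ i * 1) := by
    intro j hj
    -- `Σ_k ζ^{(m-j)k} Λ_k` computed two ways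
    have hL : ∑ k ∈ range m, ζ ^ ((m - j) * k) * ∑ i ∈ range m, F (g ^ i * 1) * ζ ^ (k * i) =
        ∑ i ∈ range m, F (g ^ i * 1) := by
      rw [sum_eq_single 0]
      · simp
      · intro k hk hk0
        rw [hvan k (Nat.pos_of_ne_zero hk0) (mem_range.mp hk), mul_zero]
      · intro h; exact absurd (mem_range.mpr hm0) h
    have hR : ∑ k ∈ range m, ζ ^ ((m - j) * k) * ∑ i ∈ range m, F (g ^ i * 1) * ζ ^ (k * i) =
        ∑ i ∈ range m, F (g ^ i * 1) * ∑ k ∈ range m, ζ ^ ((i + (m - j)) * k) := by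
      simp_rw [mul_sum]
      rw [sum_comm]
      refine sum_congr rfl fun i _ ↦ sum_congr rfl fun k _ ↦ ?_
      rw [show (i + (m - j)) * k = k * i + (m - j) * k by ring, pow_add]
      ring
    have hR' : ∑ i ∈ range m, F (g ^ i * 1) * ∑ k ∈ range m, ζ ^ ((i + (m - j)) * k) = (m : K) * F (g ^ j) := by
      have : ∀ i ∈ range m, F (g ^ i * 1) * ∑ k ∈ range m, ζ ^ ((i + (m - j)) * k) =
          if i = j then (m : K) * F (g ^ j) else 0 := by
        intro i hi
        rw [sum_pow_mul_eq hζ]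
        have hi' := mem_range.mp hi
        by_cases hij : i = j
        · subst hij
          rw [if_pos (by rw [show i + (m - i) = m by omega]), if_pos rfl, mul_one, mul_comm]
        · rw [if_neg, if_neg hij, mul_zero]
          intro hdvd
          obtain ⟨c, hc⟩ := hdvd
          have : i + (m - j) < 2 * m := by omega
          have : 0 < i + (m - j) := by omega
          rcases Nat.lt_or_ge c 2 with hc2 | hc2
          · interval_cases c <;> omega
          · have : m * c ≥ m * 2 := Nat.mul_le_mul_left m hc2
            omega
      rw [sum_congr rfl this, sum_ite_eq' (range m) j, if_pos (mem_range.mpr hj)]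
    rw [← hR', ← hR, hL]
  have hlt : ∀ j, j < m → F (g ^ j) = F 1 := by
    intro j hj
    have h1 := hkey j hj
    have h0 := hkey 0 hm0
    rw [pow_zero] at h0
    exact mul_left_cancel₀ hmK (h1.trans h0.symm)
  -- general `j = m c + r`
  have hj : g ^ j = (-1) ^ (j / m) * g ^ (j % m) := by
    conv_lhs => rw [← Nat.div_add_mod j m, pow_add, pow_mul, hgm]
  rcases neg_one_pow_eq_or (ZMod q) (j / m) with h | h
  · rw [hj, h, one_mul]; exact hlt _ (Nat.mod_lt _ hm0)
  · rw [hj, h, neg_one_mul, heven]; exact hlt _ (Nat.mod_lt _ hm0)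

end MultiHub

/-- **LEMMA MH (`MultiHubRigid q p`, Sketch-an-g30 §7 VERBATIM, by value) for every admissible pair**: `q, p` prime, `q ≥ 3`, `p ∤ (q−1)/2`. -/
theorem multiHubRigid {q p : ℕ} (hq : q.Prime) (hp : p.Prime) (hq3 : 3 ≤ q) (hadm : ¬ p ∣ (q - 1) / 2) :
    ∀ G : ZMod q → ZMod p,
      (∀ x : ZMod q, G (-x) = G x) →
      (∀ h D : ZMod q, h ≠ 0 → D ≠ 0 → D ≠ 1 →
          G h - G (h * D) - G (h * (1 - D) * D⁻¹) + G (h * (1 - D)) = 0) →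
      ∀ x y : ZMod q, x ≠ 0 → y ≠ 0 → G x = G y := by
  haveI : Fact q.Prime := ⟨hq⟩
  haveI : Fact p.Prime := ⟨hp⟩
  intro G heven hMH x y hx hy
  -- `m = (q−1)/2 ≥ 1`, `q − 1 = 2m`
  set m : ℕ := (q - 1) / 2 with hm
  have hq2 : q % 2 = 1 := Nat.odd_iff.mp (hq.odd_of_ne_two (by omega))
  have hm2 : q - 1 = 2 * m := by omega
  have hm0 : 0 < m := by omega
  -- a generator `g` of `(ℤ/q)ˣ`, `orderOf g = 2m`, `g^m = −1`
  obtain ⟨gu, hgu⟩ := IsCyclic.exists_generator (α := (ZMod q)ˣ)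
  set g : ZMod q := (gu : ZMod q) with hgdef
  have hg0 : g ≠ 0 := gu.ne_zero
  have hord : orderOf g = 2 * m := by
    rw [← hm2, hgdef, orderOf_units, orderOf_eq_card_of_forall_mem_zpowers hgu, Nat.card_eq_fintype_card, ZMod.card_units]
  have hgen : ∀ z : ZMod q, z ≠ 0 → ∃ a : ℕ, g ^ a = z := by
    intro z hz
    have hmem : Units.mk0 z hz ∈ Submonoid.powers gu := mem_powers_iff_mem_zpowers.mpr (hgu _)
    obtain ⟨a, ha⟩ := hmem
    refine ⟨a, ?_⟩
    have := congrArg Units.val ha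
    simpa [hgdef, Units.val_pow_eq_pow_val] using this
  have hgm : g ^ m = -1 := by
    have h1 : g ^ m * g ^ m = 1 := by rw [← pow_add, ← two_mul, ← hord]; exact pow_orderOf_eq_one g
    have h2 : g ^ m ≠ 1 := by
      intro h
      have hdvd := orderOf_dvd_of_pow_eq_one h
      rw [hord] at hdvd
      have := Nat.le_of_dvd hm0 hdvd
      omega
    rcases mul_self_eq_one_iff.mp h1 with h | h
    · exact absurd h h2
    · exact h
  -- the field `K = CyclotomicField m (ℤ/p)` and a primitive `m`-th root `ζ`
  haveI : NeZero m := ⟨hm0.ne'⟩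
  have hmp : ((m : ℕ) : ZMod p) ≠ 0 := by
    rw [Ne, ZMod.natCast_eq_zero_iff]
    exact hadm
  haveI : NeZero ((m : ℕ) : ZMod p) := ⟨hmp⟩
  let K := CyclotomicField m (ZMod p)
  have hζ := IsCyclotomicExtension.zeta_spec m (ZMod p) K
  set ζ : K := IsCyclotomicExtension.zeta m (ZMod p) K with hζdef
  have hmK : (m : K) ≠ 0 := by
    have : (m : K) = algebraMap (ZMod p) K (m : ZMod p) := by simp
    rw [this]
    exact (map_ne_zero_iff _ (algebraMap (ZMod p) K).injective).mpr hmp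
  -- `F = G` viewed in `K`
  set ι := algebraMap (ZMod p) K with hι
  set F : ZMod q → K := fun z ↦ ι (G z) with hF
  have hFeven : ∀ z, F (-z) = F z := fun z ↦ by simp only [hF, heven]
  have hrelF : ∀ lam w : ZMod q, lam ≠ 0 → w ≠ 0 → w ≠ 1 →
      F (lam * w) - F (lam * (w - 1)) - F (lam * (w * (w - 1)⁻¹)) + F lam = 0 := by
    intro lam w hl hw0 hw1
    have h := congrArg ι (multiHub_rel G hMH hl hw0 hw1)
    rw [map_add, map_sub, map_sub, map_zero] at h
    exact h
  have hinj : ∀ a b : ℕ, g ^ a = g ^ b → a ≡ b [MOD 2 * m] := by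
    intro a b hab
    have hu : gu ^ a = gu ^ b := by
      rw [← Units.val_inj]; push_cast; rw [← hgdef]; exact hab
    have hordu : orderOf gu = 2 * m := by
      rw [← hm2, orderOf_eq_card_of_forall_mem_zpowers hgu, Nat.card_eq_fintype_card, ZMod.card_units]
    rw [← hordu]
    exact pow_eq_pow_iff_modEq.mp hu
  have hvan : ∀ k, 0 < k → k < m → ∑ i ∈ Finset.range m, F (g ^ i * 1) * ζ ^ (k * i) = 0 :=
    fun k hk0 hkm ↦ charSum_eq_zero F hm0 hinj hg0 hgen hζ hFeven hgm hrelF hk0 hkm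
  have hconst := apply_pow_eq_of_charSum_eq_zero F hm0 hζ hmK hFeven hgm hvan
  obtain ⟨jx, hjx⟩ := hgen x hx
  obtain ⟨jy, hjy⟩ := hgen y hy
  have hFxy : F x = F y := by rw [← hjx, ← hjy, hconst, hconst]
  exact (algebraMap (ZMod p) K).injective hFxy

/-- **an's `MultiHubRigidLaw` (Sketch-an-g30 §7 VERBATIM, by value) is a THEOREM** — LEMMA MH for all admissible `(q, p)`. -/
theorem multiHubRigidLaw :
    ∀ q p : ℕ, q.Prime → p.Prime → 3 ≤ q → q ≠ p → ¬ p ∣ (q - 1) / 2 →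
      ∀ G : ZMod q → ZMod p,
        (∀ x : ZMod q, G (-x) = G x) →
        (∀ h D : ZMod q, h ≠ 0 → D ≠ 0 → D ≠ 1 →
            G h - G (h * D) - G (h * (1 - D) * D⁻¹) + G (h * (1 - D)) = 0) →
        ∀ x y : ZMod q, x ≠ 0 → y ≠ 0 → G x = G y :=
  fun _ _ hq hp hq3 _ hadm ↦ multiHubRigid hq hp hq3 hadm

end Summit.BirchSwinnertonDyer.BirchSwinnertonDyer.Theorems.ManinLocalTwoThree
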